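import Mathlib
import Summits.AtomisticToContinuum.Crystallization.Theorems.NashClassCertificatesNashNearFieldStubTriLandscapeTails

/-!
# Crux `NashNearField` (16827), stubs `stub_triLandscapeNear` / `stub_triLandscapeFar`: certified truncation II —
# summability, finite part plus controlled tail, whole-layer constants

On the planar majorant of `…StubTriLandscapeTails`:
* `tri_abs_tsum_sub_sum_le` / `tri_sum_sub_le_tsum` — for a summable `g : ℤ² → ℝ` and a finite `F`, if all absolute partial sums
  over finite sets DISJOINT from `F` are `≤ τ` then `|∑' g − ∑_F g| ≤ τ` (`Summable.sum_add_tsum_compl` + `Real.tsum_le_of_sum_le` on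
  the complement subtype); `tri_abs_tsum_le_of_sum_abs_le` — whole-`ℤ²` version;
* `tri_summable_deformed` (`s ≠ 0`), `tri_summable_deformed_inLayer` (`s = 0 = δ`; origin term `V 0 = 0`, `Q_0 ≥ 1` off the
  origin) — summability of the deformed layer sums of the triangular gauge from the uniform partial-sum bounds (tube), and
  `tri_summable_reference(_inLayer)` for `layerInteraction V_LJ a h δ s` at a box cell — no periodic-configuration detour;
* `tri_wholeLayer_bound_le` — the whole-layer majorant at `c₂ = κ s²` is `≤ (κ⁻³/12 + 1/6)·10((κ³)⁻¹ + (a₁²κ²)⁻¹)·s⁻⁴` (`s ≠ 0`),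
  the constant that the layer-count tail `∑_{|s|>K}` of `W` is summed against (`∑_{n>K} n⁻⁴ ≤ (4/3)K⁻³`, `BarlowCouplingDecay`).
-/

noncomputable section

open scoped BigOperators
open Literature.MathematicalPhysics.StatisticalMechanics Literature.Geometry.DiscreteGeometry

namespace Summit.AtomisticToContinuum.Crystallization.Theorems.NashClassCertificatesNashNearField

/-! ## Generic: splitting a summable `ℤ²`-sum into a finite part and a controlled tail -/

/-- **Finite part plus controlled tail.**  If `g : ℤ² → ℝ` is summable and all absolute partial sums over finite sets
disjoint from `F` are `≤ τ`, then `|∑' g − ∑_F g| ≤ τ`. [folklore] -/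
theorem tri_abs_tsum_sub_sum_le {g : ℤ × ℤ → ℝ} (hg : Summable g) (F : Finset (ℤ × ℤ)) {τ : ℝ}
    (hτ : ∀ u : Finset (ℤ × ℤ), Disjoint u F → ∑ ij ∈ u, |g ij| ≤ τ) :
    |∑' ij, g ij - ∑ ij ∈ F, g ij| ≤ τ := by
  classical
  rw [← hg.sum_add_tsum_compl (s := F), add_sub_cancel_left]
  have hga : Summable fun x : ↥((F : Set (ℤ × ℤ))ᶜ) => |g x| :=
    (hg.abs).subtype _
  calc |∑' x : ↥((F : Set (ℤ × ℤ))ᶜ), g x| ≤ ∑' x : ↥((F : Set (ℤ × ℤ))ᶜ), |g x| := by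
        have := norm_tsum_le_tsum_norm (f := fun x : ↥((F : Set (ℤ × ℤ))ᶜ) => g x)
          (by simpa only [Real.norm_eq_abs] using hga)
        simpa only [Real.norm_eq_abs] using this
    _ ≤ τ := by
        refine Real.tsum_le_of_sum_le (fun x => abs_nonneg _) fun u => ?_
        have hdisj : Disjoint (u.map (Function.Embedding.subtype _)) F := by
          rw [Finset.disjoint_left]
          rintro ij hij hijF
          obtain ⟨x, _, rfl⟩ := Finset.mem_map.1 hij
          exact x.2 hijF
        have := hτ _ hdisj
        rwa [Finset.sum_map] at this

/-- The same, as a two-sided estimate. [folklore] -/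
theorem tri_sum_sub_le_tsum {g : ℤ × ℤ → ℝ} (hg : Summable g) (F : Finset (ℤ × ℤ)) {τ : ℝ}
    (hτ : ∀ u : Finset (ℤ × ℤ), Disjoint u F → ∑ ij ∈ u, |g ij| ≤ τ) :
    ∑ ij ∈ F, g ij - τ ≤ ∑' ij, g ij ∧ ∑' ij, g ij ≤ ∑ ij ∈ F, g ij + τ := by
  have h := abs_le.1 (tri_abs_tsum_sub_sum_le hg F hτ)
  constructor <;> linarith [h.1, h.2]

/-- A whole-`ℤ²` bound on the absolute partial sums bounds the `tsum` in absolute value. [folklore] -/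
theorem tri_abs_tsum_le_of_sum_abs_le {g : ℤ × ℤ → ℝ} {c : ℝ} (h : ∀ u : Finset (ℤ × ℤ), ∑ ij ∈ u, |g ij| ≤ c) :
    |∑' ij, g ij| ≤ c := by
  have hga : Summable fun ij => |g ij| := summable_of_sum_le (fun _ => abs_nonneg _) h
  calc |∑' ij, g ij| ≤ ∑' ij, |g ij| := by
        have := norm_tsum_le_tsum_norm (f := g) (by simpa only [Real.norm_eq_abs] using hga)
        simpa only [Real.norm_eq_abs] using this
    _ ≤ c := Real.tsum_le_of_sum_le (fun _ => abs_nonneg _) h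

/-! ## The deformed layer sums of the triangular gauge -/

section Deformed

variable (t₀₀ t₀₁ t₀₂ t₁₁ t₁₂ t₂₂ : ℝ)

/-- Summability over `ℤ²` of the deformed layer sum at layer distance `s ≠ 0` (any offset), from the uniform partial-sum bound.
[folklore] -/
theorem tri_summable_deformed
    (htube : ∀ x y z : ℝ, (4 / 5 : ℝ) ^ 2 * (x ^ 2 + y ^ 2 + z ^ 2) ≤
      (t₀₀ * x + t₀₁ * y + t₀₂ * z) ^ 2 + (t₁₁ * y + t₁₂ * z) ^ 2 + (t₂₂ * z) ^ 2 ∧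
      (t₀₀ * x + t₀₁ * y + t₀₂ * z) ^ 2 + (t₁₁ * y + t₁₂ * z) ^ 2 + (t₂₂ * z) ^ 2 ≤
        (6 / 5 : ℝ) ^ 2 * (x ^ 2 + y ^ 2 + z ^ 2))
    (δ s : ℤ) (hs : s ≠ 0) :
    Summable fun ij : ℤ × ℤ => lennardJones (Real.sqrt
        ((t₀₀ * ((ij.1 : ℝ) + (ij.2 : ℝ) / 2 + (δ : ℝ) / 2) + t₀₁ * (Real.sqrt 3 / 2 * ((ij.2 : ℝ) + (δ : ℝ) / 3)) +
            t₀₂ * ((s : ℝ) * (Real.sqrt 6 / 3))) ^ 2 +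
          (t₁₁ * (Real.sqrt 3 / 2 * ((ij.2 : ℝ) + (δ : ℝ) / 3)) + t₁₂ * ((s : ℝ) * (Real.sqrt 6 / 3))) ^ 2 +
          (t₂₂ * ((s : ℝ) * (Real.sqrt 6 / 3))) ^ 2)) := by
  have hs' : (0 : ℝ) < (s : ℝ) ^ 2 := by
    have : (s : ℝ) ≠ 0 := by exact_mod_cast hs
    positivity
  have hβ : 0 < 16 / 25 * ((0 : ℕ) : ℝ) + 32 / 75 * (s : ℝ) ^ 2 := by
    rw [Nat.cast_zero, mul_zero, zero_add]; positivity
  exact Summable.of_abs (summable_of_sum_le (fun _ => abs_nonneg _) fun F =>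
    tri_sum_abs_deformed_le t₀₀ t₀₁ t₀₂ t₁₁ t₁₂ t₂₂ htube δ s 0 hβ F
      fun ij _ => by rw [Nat.cast_zero]; positivity)

/-- Summability over `ℤ²` of the deformed in-layer sum (`s = 0`, `δ = 0`; the origin term is `V 0 = 0`). [folklore] -/
theorem tri_summable_deformed_inLayer
    (htube : ∀ x y z : ℝ, (4 / 5 : ℝ) ^ 2 * (x ^ 2 + y ^ 2 + z ^ 2) ≤
      (t₀₀ * x + t₀₁ * y + t₀₂ * z) ^ 2 + (t₁₁ * y + t₁₂ * z) ^ 2 + (t₂₂ * z) ^ 2 ∧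
      (t₀₀ * x + t₀₁ * y + t₀₂ * z) ^ 2 + (t₁₁ * y + t₁₂ * z) ^ 2 + (t₂₂ * z) ^ 2 ≤
        (6 / 5 : ℝ) ^ 2 * (x ^ 2 + y ^ 2 + z ^ 2)) :
    Summable fun ij : ℤ × ℤ => lennardJones (Real.sqrt
        ((t₀₀ * ((ij.1 : ℝ) + (ij.2 : ℝ) / 2 + ((0 : ℤ) : ℝ) / 2) +
              t₀₁ * (Real.sqrt 3 / 2 * ((ij.2 : ℝ) + ((0 : ℤ) : ℝ) / 3)) + t₀₂ * (((0 : ℤ) : ℝ) * (Real.sqrt 6 / 3))) ^ 2 +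
          (t₁₁ * (Real.sqrt 3 / 2 * ((ij.2 : ℝ) + ((0 : ℤ) : ℝ) / 3)) + t₁₂ * (((0 : ℤ) : ℝ) * (Real.sqrt 6 / 3))) ^ 2 +
          (t₂₂ * (((0 : ℤ) : ℝ) * (Real.sqrt 6 / 3))) ^ 2)) := by
  have hβ : 0 < 16 / 25 * ((1 : ℕ) : ℝ) + 32 / 75 * (((0 : ℤ) : ℝ)) ^ 2 := by norm_num
  exact tri_summable_of_sum_erase_le ((0, 0) : ℤ × ℤ) (by simp [lennardJones_zero]) fun F hF =>
    tri_sum_abs_deformed_le t₀₀ t₀₁ t₀₂ t₁₁ t₁₂ t₂₂ htube 0 0 1 hβ F fun ij hij => by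
      rw [Nat.cast_one]
      exact tri_one_le_planarForm_zero (by rintro rfl; exact hF hij)

end Deformed

/-! ## The reference layer sums -/

/-- Summability over `ℤ²` of the reference layer sum `layerInteraction V_LJ a h δ s` at a box cell, `s ≠ 0`. [folklore] -/
theorem tri_summable_reference {a h : ℝ} (ha : 47 / 50 ≤ a) (hh : 39 / 50 * a ≤ h) (δ s : ℤ) (hs : s ≠ 0) :
    Summable fun ij : ℤ × ℤ => lennardJones ‖layerVec a h δ s ij.1 ij.2‖ := by
  have hs' : (0 : ℝ) < (s : ℝ) ^ 2 := by
    have : (s : ℝ) ≠ 0 := by exact_mod_cast hs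
    positivity
  have hβ : 0 < (47 / 50 : ℝ) ^ 2 * ((0 : ℕ) : ℝ) + (s : ℝ) ^ 2 * (1833 / 2500 : ℝ) ^ 2 := by
    rw [Nat.cast_zero, mul_zero, zero_add]; positivity
  exact Summable.of_abs (summable_of_sum_le (fun _ => abs_nonneg _) fun F =>
    tri_sum_abs_reference_le ha hh δ s 0 hβ F fun ij _ => by rw [Nat.cast_zero]; positivity)

/-- Summability over `ℤ²` of the reference in-layer sum (`s = 0`, `δ = 0`). [folklore] -/
theorem tri_summable_reference_inLayer {a h : ℝ} (ha : 47 / 50 ≤ a) (hh : 39 / 50 * a ≤ h) :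
    Summable fun ij : ℤ × ℤ => lennardJones ‖layerVec a h 0 0 ij.1 ij.2‖ := by
  have hβ : 0 < (47 / 50 : ℝ) ^ 2 * ((1 : ℕ) : ℝ) + (((0 : ℤ) : ℝ)) ^ 2 * (1833 / 2500 : ℝ) ^ 2 := by norm_num
  exact tri_summable_of_sum_erase_le ((0, 0) : ℤ × ℤ) (by simp [cbbc_layerVec_zero, lennardJones_zero]) fun F hF =>
    tri_sum_abs_reference_le ha hh 0 0 1 hβ F fun ij hij => by
      rw [Nat.cast_one]
      exact tri_one_le_planarForm_zero (by rintro rfl; exact hF hij)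

/-! ## Whole-layer constants: `BOUND(a₁², κ s², 0) ≤ C(a₁², κ)·s⁻⁴` -/

/-- The whole-layer planar majorant at `c₂ = κ s²` is `≤ (κ⁻³/12 + 1/6)·10((κ³)⁻¹ + (a₁² κ²)⁻¹)·s⁻⁴` for `s ≠ 0`. [folklore] -/
theorem tri_wholeLayer_bound_le {a₁sq κ : ℝ} (ha : 0 < a₁sq) (hκ : 0 < κ) (s : ℤ) (hs : s ≠ 0) :
    ((a₁sq * ((0 : ℕ) : ℝ) + κ * (s : ℝ) ^ 2)⁻¹ ^ 3 / 12 + 1 / 6) *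
        (10 * (((a₁sq * ((0 : ℕ) : ℝ) + κ * (s : ℝ) ^ 2) ^ 3)⁻¹ +
            1 / (a₁sq * (a₁sq * ((0 : ℕ) : ℝ) + κ * (s : ℝ) ^ 2) ^ 2)) +
          10 * ((0 : ℕ) : ℝ) * ((a₁sq * ((0 : ℕ) : ℝ) + κ * (s : ℝ) ^ 2) ^ 3)⁻¹) ≤
      (κ⁻¹ ^ 3 / 12 + 1 / 6) * (10 * ((κ ^ 3)⁻¹ + (a₁sq * κ ^ 2)⁻¹)) * (((s : ℝ) ^ 2) ^ 2)⁻¹ := by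
  have hs1 : (1 : ℝ) ≤ (s : ℝ) ^ 2 := by
    have h1 : (1 : ℤ) ≤ |s| := Int.one_le_abs hs
    have h2 : (1 : ℝ) ≤ |(s : ℝ)| := by rw [← Int.cast_abs]; exact_mod_cast h1
    nlinarith [sq_abs (s : ℝ), abs_nonneg (s : ℝ)]
  set S : ℝ := (s : ℝ) ^ 2 with hS
  have hS0 : 0 < S := by linarith
  simp only [Nat.cast_zero, mul_zero, zero_add, zero_mul, add_zero]
  -- `(κ S)⁻¹ ≤ κ⁻¹`, `((κ S)³)⁻¹ ≤ (κ³)⁻¹ (S²)⁻¹`, `1/(a₁² (κS)²) = (a₁² κ²)⁻¹ (S²)⁻¹`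
  have h1 : (κ * S)⁻¹ ≤ κ⁻¹ := by
    apply inv_anti₀ hκ; nlinarith
  have h2 : ((κ * S) ^ 3)⁻¹ ≤ (κ ^ 3)⁻¹ * (S ^ 2)⁻¹ := by
    rw [← mul_inv, mul_pow]
    apply inv_anti₀ (by positivity)
    have : S ^ 2 ≤ S ^ 3 := by nlinarith [mul_pos hS0 hS0]
    exact mul_le_mul_of_nonneg_left this (by positivity)
  have h3 : 1 / (a₁sq * (κ * S) ^ 2) = (a₁sq * κ ^ 2)⁻¹ * (S ^ 2)⁻¹ := by
    rw [one_div, ← mul_inv]; ring_nf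
  have hA : (κ * S)⁻¹ ^ 3 / 12 + 1 / 6 ≤ κ⁻¹ ^ 3 / 12 + 1 / 6 := by
    gcongr
  have hA0 : 0 ≤ (κ * S)⁻¹ ^ 3 / 12 + 1 / 6 := by positivity
  have hB : 10 * (((κ * S) ^ 3)⁻¹ + 1 / (a₁sq * (κ * S) ^ 2)) ≤
      10 * ((κ ^ 3)⁻¹ + (a₁sq * κ ^ 2)⁻¹) * (S ^ 2)⁻¹ := by
    rw [h3]; nlinarith [h2]
  have hB0 : 0 ≤ 10 * (((κ * S) ^ 3)⁻¹ + 1 / (a₁sq * (κ * S) ^ 2)) := by positivity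
  calc ((κ * S)⁻¹ ^ 3 / 12 + 1 / 6) * (10 * (((κ * S) ^ 3)⁻¹ + 1 / (a₁sq * (κ * S) ^ 2)))
      ≤ (κ⁻¹ ^ 3 / 12 + 1 / 6) * (10 * ((κ ^ 3)⁻¹ + (a₁sq * κ ^ 2)⁻¹) * (S ^ 2)⁻¹) :=
        mul_le_mul hA hB hB0 (by positivity)
    _ = (κ⁻¹ ^ 3 / 12 + 1 / 6) * (10 * ((κ ^ 3)⁻¹ + (a₁sq * κ ^ 2)⁻¹)) * (S ^ 2)⁻¹ := by ring

end Summit.AtomisticToContinuum.Crystallization.Theorems.NashClassCertificatesNashNearField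

end
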